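import Mathlib
import Literature.Combinatorics.Additive.TPPGroupAlgebra
import Literature.RepresentationTheory.FiniteGroups.WedderburnBlocks
import Summits.MatrixMultiplication.MatrixMultiplication.Theorems.SnSubsetDichotomyGlobalBranchStubBlockDictionary
import Summits.MatrixMultiplication.MatrixMultiplication.Theorems.SnSubsetDichotomyPolynomialSlackHookCharacters

/-!
# The four low Wedderburn blocks of the six-fold TPP convolution in `ℂ[S_n]`

Helper file for the LEVEL-ONE programme on the crux `SnSubsetDichotomy.PolynomialSlack`
(stmt-MatrixMultiplication-8306). For `S, T, U ⊆ S_n` write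
`z = 𝟙_{S⁻¹}𝟙_T · 𝟙_{T⁻¹}𝟙_U · 𝟙_{U⁻¹}𝟙_S ∈ ℂ[S_n]`, the element whose Wedderburn blocks carry the
BCGPU identity `n!·|S||T||U| = Σᵢ dᵢ tr(zᵢ)` (tree proof of `BCGPU2023_thm32_holds`). Here:

* `trace_block_six` — `tr(φ(z)ᵢ) = Σ χᵢ(s⁻¹t·t'⁻¹u·u'⁻¹s')` over `S×T×T×U×U×S` (linearity);
* `exists_partition_sortedParts_eq` — partitions with prescribed sorted parts exist;
* for a block whose character is `χ^μ` (`stub_blockDictionary`), the trace of `zᵢ` is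
  `N²` if `μ = (n)` (`trace_six_of_single`), `T₃ - N²` if `μ = (n-1,1)` (`trace_six_of_hook`), and, when
  each of `S, T, U` lies in ONE sign class (parity-pure), again `N²` for `μ = (1ⁿ)` and `T₃ - N²` for
  `μ = (2,1^{n-2})` (`trace_six_of_column`, `trace_six_of_twoColumn`); here `N = |S||T||U|` and
  `T₃ = Σ #fix(s⁻¹t·t'⁻¹u·u'⁻¹s')` is the SIX-FOLD FIXED-POINT COUNT, the level-one datum of the
  triple (it equals `N²·E[fix]` for the product of three independent quotient elements);
* the corresponding block dimensions are `1, n-1, 1, n-1` (`degree_of_…`).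

References: Blasiak–Cohn–Grochow–Pratt–Umans 2023 (arXiv:2204.03826), proof of Thm. 3.2;
Fulton–Harris GTM 129, Ex. 4.6.
-/

namespace Summit.MatrixMultiplication.MatrixMultiplication.Theorems.PolynomialSlack

open scoped BigOperators Matrix
open Literature.Combinatorics.Additive (indicatorElem indicatorElemInv indicatorElem_def
  indicatorElemInv_def sum_single_mul_sum_single)
open Literature.NumberTheory.DiophantineGeometry (spechtCharacter numStandardTableaux)
open Literature.RepresentationTheory.FiniteGroups (BlockAlgebraC blockRep character_blockRep_apply)
open Summit.MatrixMultiplication.MatrixMultiplication.Theorems.GlobalBranch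
  (blockDictionary_character_blockRep_one)

-- `Summit.<Summit>.<Problem>` is the tree's mandated summit-side namespace (CONVENTIONS §2); for
-- this single-conjunct summit the two coincide, so each declaration silences `dupNamespace`.
set_option linter.dupNamespace false

/-! ## Partitions with prescribed sorted parts -/

/-- A weakly decreasing list of positive naturals summing to `m` is the list of sorted parts of a
partition of `m`. [folklore] -/
theorem exists_partition_sortedParts_eq {m : ℕ} (L : List ℕ) (hpos : ∀ a ∈ L, 0 < a)
    (hsort : L.Pairwise (· ≥ ·)) (hsum : L.sum = m) : ∃ μ : Nat.Partition m, μ.sortedParts = L := by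
  refine ⟨{ parts := (L : Multiset ℕ)
            parts_pos := fun h => hpos _ (Multiset.mem_coe.1 h)
            parts_sum := by rw [Multiset.sum_coe, hsum] }, ?_⟩
  exact sortedParts_eq_of_parts_eq _ hsort rfl

/-- The partition `(n)`. [folklore] -/
theorem exists_partition_single {n : ℕ} (hn : 1 ≤ n) : ∃ μ : Nat.Partition n, μ.sortedParts = [n] :=
  exists_partition_sortedParts_eq _ (by simp; omega) (List.pairwise_singleton _ _) (by simp)

/-- The partition `(n-1, 1)`. [folklore] -/
theorem exists_partition_hook {n : ℕ} (hn : 2 ≤ n) : ∃ μ : Nat.Partition n, μ.sortedParts = [n - 1, 1] :=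
  exists_partition_sortedParts_eq _ (by simp; omega) (by simp; omega) (by simp; omega)

/-- The partition `(1ⁿ)`. [folklore] -/
theorem exists_partition_column (n : ℕ) : ∃ μ : Nat.Partition n, μ.sortedParts = List.replicate n 1 :=
  exists_partition_sortedParts_eq _ (fun a ha => by rw [List.eq_of_mem_replicate ha]; exact one_pos)
    (List.pairwise_replicate.2 (Or.inr le_rfl)) (by simp)

/-- The partition `(2, 1^{n-2})`. [folklore] -/
theorem exists_partition_twoColumn {n : ℕ} (hn : 2 ≤ n) :
    ∃ μ : Nat.Partition n, μ.sortedParts = 2 :: List.replicate (n - 2) 1 :=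
  exists_partition_sortedParts_eq _
    (fun a ha => by
      rcases List.mem_cons.1 ha with rfl | ha
      · exact two_pos
      · rw [List.eq_of_mem_replicate ha]; exact one_pos)
    (List.pairwise_cons.2 ⟨fun b hb => by rw [List.eq_of_mem_replicate hb]; omega,
      List.pairwise_replicate.2 (Or.inr le_rfl)⟩)
    (by simp; omega)

/-! ## The six-fold expansion and the block traces -/

section Six

variable {G : Type} [Group G]

/-- `𝟙_{S⁻¹}𝟙_T · 𝟙_{T⁻¹}𝟙_U · 𝟙_{U⁻¹}𝟙_S = Σ (s⁻¹t)(t'⁻¹u)(u'⁻¹s')` over `(S×T)×(T×U)×(U×S)`.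
[folklore] -/
theorem six_eq_sum_single [DecidableEq G] (S T U : Finset G) :
    (indicatorElemInv ℂ S * indicatorElem ℂ T) * (indicatorElemInv ℂ T * indicatorElem ℂ U) *
        (indicatorElemInv ℂ U * indicatorElem ℂ S) =
      ∑ y ∈ ((S ×ˢ T) ×ˢ (T ×ˢ U)) ×ˢ (U ×ˢ S),
        MonoidAlgebra.single (y.1.1.1⁻¹ * y.1.1.2 * (y.1.2.1⁻¹ * y.1.2.2) * (y.2.1⁻¹ * y.2.2)) (1 : ℂ) := by
  rw [indicatorElemInv_def, indicatorElem_def, indicatorElemInv_def, indicatorElem_def,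
    indicatorElemInv_def, indicatorElem_def, sum_single_mul_sum_single,
    sum_single_mul_sum_single, sum_single_mul_sum_single, sum_single_mul_sum_single,
    sum_single_mul_sum_single]

variable {r : ℕ} {d : Fin r → ℕ}

/-- **Block trace of the six-fold product**: `tr(φ(z)ᵢ) = Σ χᵢ(s⁻¹t·t'⁻¹u·u'⁻¹s')` over
`(S×T)×(T×U)×(U×S)`. [folklore] -/
theorem trace_block_six [DecidableEq G] (φ : MonoidAlgebra ℂ G ≃ₐ[ℂ] BlockAlgebraC d) (i : Fin r)
    (S T U : Finset G) :
    Matrix.trace (φ ((indicatorElemInv ℂ S * indicatorElem ℂ T) *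
        (indicatorElemInv ℂ T * indicatorElem ℂ U) * (indicatorElemInv ℂ U * indicatorElem ℂ S)) i) =
      ∑ y ∈ ((S ×ˢ T) ×ˢ (T ×ˢ U)) ×ˢ (U ×ˢ S),
        (blockRep φ i).character (y.1.1.1⁻¹ * y.1.1.2 * (y.1.2.1⁻¹ * y.1.2.2) * (y.2.1⁻¹ * y.2.2)) := by
  rw [six_eq_sum_single, map_sum, Finset.sum_apply, Matrix.trace_sum]
  refine Finset.sum_congr rfl fun y _ => ?_
  rw [character_blockRep_apply]

end Six

/-- The six-fold product set has `(|S||T||U|)²` elements. [folklore] -/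
theorem card_six {α : Type*} (S T U : Finset α) :
    (((S ×ˢ T) ×ˢ (T ×ˢ U)) ×ˢ (U ×ˢ S)).card = (S.card * T.card * U.card) ^ 2 := by
  simp only [Finset.card_product]; ring

/-! ## Parity-pure sets: the six-fold words are even -/

section Parity

variable {n : ℕ}

/-- Equal signs multiply to `1`. [folklore] -/
theorem sign_mul_sign_of_eq {σ τ : Equiv.Perm (Fin n)} (h : Equiv.Perm.sign σ = Equiv.Perm.sign τ) :
    Equiv.Perm.sign σ * Equiv.Perm.sign τ = 1 := by
  rw [h, Int.units_mul_self]

/-- If each of `S, T, U` lies in one sign class then every word `s⁻¹t·t'⁻¹u·u'⁻¹s'` is even.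
[folklore] -/
theorem sign_six_eq_one {S T U : Finset (Equiv.Perm (Fin n))}
    (hS : ∀ s ∈ S, ∀ s' ∈ S, Equiv.Perm.sign s = Equiv.Perm.sign s')
    (hT : ∀ t ∈ T, ∀ t' ∈ T, Equiv.Perm.sign t = Equiv.Perm.sign t')
    (hU : ∀ u ∈ U, ∀ u' ∈ U, Equiv.Perm.sign u = Equiv.Perm.sign u')
    {y : ((Equiv.Perm (Fin n) × Equiv.Perm (Fin n)) × (Equiv.Perm (Fin n) × Equiv.Perm (Fin n))) ×
      (Equiv.Perm (Fin n) × Equiv.Perm (Fin n))}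
    (hy : y ∈ ((S ×ˢ T) ×ˢ (T ×ˢ U)) ×ˢ (U ×ˢ S)) :
    Equiv.Perm.sign (y.1.1.1⁻¹ * y.1.1.2 * (y.1.2.1⁻¹ * y.1.2.2) * (y.2.1⁻¹ * y.2.2)) = 1 := by
  obtain ⟨⟨⟨s, t⟩, ⟨t', u⟩⟩, ⟨u', s'⟩⟩ := y
  simp only [Finset.mem_product] at hy
  obtain ⟨⟨⟨hs, ht⟩, ht', hu⟩, hu', hs'⟩ := hy
  simp only [map_mul, map_inv, Int.units_inv_eq_self]
  calc Equiv.Perm.sign s * Equiv.Perm.sign t * (Equiv.Perm.sign t' * Equiv.Perm.sign u) *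
        (Equiv.Perm.sign u' * Equiv.Perm.sign s')
      = (Equiv.Perm.sign s * Equiv.Perm.sign s') * (Equiv.Perm.sign t * Equiv.Perm.sign t') *
          (Equiv.Perm.sign u * Equiv.Perm.sign u') := by
        simp only [mul_comm, mul_left_comm]
    _ = 1 := by
        rw [sign_mul_sign_of_eq (hS s hs s' hs'), sign_mul_sign_of_eq (hT t ht t' ht'),
          sign_mul_sign_of_eq (hU u hu u' hu')]; simp

end Parity

/-! ## The four low blocks evaluated -/

section LowBlocks

variable {n r : ℕ} {d : Fin r → ℕ}

/-- The block of `(n)`: `tr(zᵢ) = N²`. [folklore] -/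
theorem trace_six_of_single (φ : MonoidAlgebra ℂ (Equiv.Perm (Fin n)) ≃ₐ[ℂ] BlockAlgebraC d)
    (part : Fin r → Nat.Partition n) (hchar : ∀ i, (blockRep φ i).character = spechtCharacter ℂ (part i))
    (S T U : Finset (Equiv.Perm (Fin n)))
    {i : Fin r} (h : (part i).sortedParts = [n]) :
    Matrix.trace (φ ((indicatorElemInv ℂ S * indicatorElem ℂ T) *
        (indicatorElemInv ℂ T * indicatorElem ℂ U) * (indicatorElemInv ℂ U * indicatorElem ℂ S)) i) =
      (((S.card * T.card * U.card) ^ 2 : ℕ) : ℂ) := by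
  rw [trace_block_six, hchar i]
  simp only [spechtCharacter_of_sortedParts_eq_single (part i) h, Finset.sum_const, nsmul_eq_mul,
    mul_one, card_six]

/-- The block of `(n)` has dimension `1`. [folklore] -/
theorem degree_of_single (φ : MonoidAlgebra ℂ (Equiv.Perm (Fin n)) ≃ₐ[ℂ] BlockAlgebraC d)
    (part : Fin r → Nat.Partition n) (hchar : ∀ i, (blockRep φ i).character = spechtCharacter ℂ (part i))
    {i : Fin r} (h : (part i).sortedParts = [n]) : d i = 1 := by
  have h1 := blockDictionary_character_blockRep_one φ i
  rw [hchar i, spechtCharacter_of_sortedParts_eq_single (part i) h] at h1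
  exact_mod_cast h1.symm

/-- The block of `(n-1, 1)`: `tr(zᵢ) = T₃ - N²` with `T₃` the six-fold fixed-point count. [folklore] -/
theorem trace_six_of_hook (φ : MonoidAlgebra ℂ (Equiv.Perm (Fin n)) ≃ₐ[ℂ] BlockAlgebraC d)
    (part : Fin r → Nat.Partition n) (hchar : ∀ i, (blockRep φ i).character = spechtCharacter ℂ (part i))
    (S T U : Finset (Equiv.Perm (Fin n)))
    (hn : 2 ≤ n) {i : Fin r} (h : (part i).sortedParts = [n - 1, 1]) :
    Matrix.trace (φ ((indicatorElemInv ℂ S * indicatorElem ℂ T) *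
        (indicatorElemInv ℂ T * indicatorElem ℂ U) * (indicatorElemInv ℂ U * indicatorElem ℂ S)) i) =
      ((∑ y ∈ ((S ×ˢ T) ×ˢ (T ×ˢ U)) ×ˢ (U ×ˢ S),
          (Finset.univ.filter fun p : Fin n =>
            (y.1.1.1⁻¹ * y.1.1.2 * (y.1.2.1⁻¹ * y.1.2.2) * (y.2.1⁻¹ * y.2.2)) p = p).card : ℕ) : ℂ) -
        (((S.card * T.card * U.card) ^ 2 : ℕ) : ℂ) := by
  rw [trace_block_six, hchar i]
  simp only [spechtCharacter_of_sortedParts_eq_hook (part i) hn h, Finset.sum_sub_distrib,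
    Finset.sum_const, nsmul_eq_mul, mul_one, card_six, Nat.cast_sum]

/-- The block of `(n-1, 1)` has dimension `n - 1`. [folklore] -/
theorem degree_of_hook (φ : MonoidAlgebra ℂ (Equiv.Perm (Fin n)) ≃ₐ[ℂ] BlockAlgebraC d)
    (part : Fin r → Nat.Partition n) (hchar : ∀ i, (blockRep φ i).character = spechtCharacter ℂ (part i))
    (hn : 2 ≤ n) {i : Fin r} (h : (part i).sortedParts = [n - 1, 1]) :
    d i = n - 1 := by
  have h1 := blockDictionary_character_blockRep_one φ i
  rw [hchar i, spechtCharacter_of_sortedParts_eq_hook (part i) hn h] at h1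
  simp only [Equiv.Perm.coe_one, id_eq, Finset.filter_true_of_mem, Finset.mem_univ,
    implies_true, Finset.card_univ, Fintype.card_fin] at h1
  have h2 : ((n : ℂ) - 1) = ((n - 1 : ℕ) : ℂ) := by
    rw [Nat.cast_sub (by omega)]; simp
  rw [h2] at h1
  exact_mod_cast h1.symm

/-- The block of `(1ⁿ)`, parity-pure sets: `tr(zᵢ) = N²`. [folklore] -/
theorem trace_six_of_column (φ : MonoidAlgebra ℂ (Equiv.Perm (Fin n)) ≃ₐ[ℂ] BlockAlgebraC d)
    (part : Fin r → Nat.Partition n) (hchar : ∀ i, (blockRep φ i).character = spechtCharacter ℂ (part i))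
    (S T U : Finset (Equiv.Perm (Fin n)))
    (hS : ∀ s ∈ S, ∀ s' ∈ S, Equiv.Perm.sign s = Equiv.Perm.sign s')
    (hT : ∀ t ∈ T, ∀ t' ∈ T, Equiv.Perm.sign t = Equiv.Perm.sign t')
    (hU : ∀ u ∈ U, ∀ u' ∈ U, Equiv.Perm.sign u = Equiv.Perm.sign u')
    (hn : 1 ≤ n) {i : Fin r} (h : (part i).sortedParts = List.replicate n 1) :
    Matrix.trace (φ ((indicatorElemInv ℂ S * indicatorElem ℂ T) *
        (indicatorElemInv ℂ T * indicatorElem ℂ U) * (indicatorElemInv ℂ U * indicatorElem ℂ S)) i) =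
      (((S.card * T.card * U.card) ^ 2 : ℕ) : ℂ) := by
  rw [trace_block_six, hchar i]
  rw [Finset.sum_congr rfl fun y hy => by
    rw [spechtCharacter_of_sortedParts_eq_column (part i) hn h, sign_six_eq_one hS hT hU hy]]
  simp only [Units.val_one, Int.cast_one, Finset.sum_const, nsmul_eq_mul, mul_one, card_six]

/-- The block of `(1ⁿ)` has dimension `1`. [folklore] -/
theorem degree_of_column (φ : MonoidAlgebra ℂ (Equiv.Perm (Fin n)) ≃ₐ[ℂ] BlockAlgebraC d)
    (part : Fin r → Nat.Partition n) (hchar : ∀ i, (blockRep φ i).character = spechtCharacter ℂ (part i))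
    (hn : 1 ≤ n) {i : Fin r} (h : (part i).sortedParts = List.replicate n 1) :
    d i = 1 := by
  have h1 := blockDictionary_character_blockRep_one φ i
  rw [hchar i, spechtCharacter_of_sortedParts_eq_column (part i) hn h, Equiv.Perm.sign_one,
    Units.val_one, Int.cast_one] at h1
  exact_mod_cast h1.symm

/-- The block of `(2, 1^{n-2})`, parity-pure sets: `tr(zᵢ) = T₃ - N²`. [folklore] -/
theorem trace_six_of_twoColumn (φ : MonoidAlgebra ℂ (Equiv.Perm (Fin n)) ≃ₐ[ℂ] BlockAlgebraC d)
    (part : Fin r → Nat.Partition n) (hchar : ∀ i, (blockRep φ i).character = spechtCharacter ℂ (part i))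
    (S T U : Finset (Equiv.Perm (Fin n)))
    (hS : ∀ s ∈ S, ∀ s' ∈ S, Equiv.Perm.sign s = Equiv.Perm.sign s')
    (hT : ∀ t ∈ T, ∀ t' ∈ T, Equiv.Perm.sign t = Equiv.Perm.sign t')
    (hU : ∀ u ∈ U, ∀ u' ∈ U, Equiv.Perm.sign u = Equiv.Perm.sign u')
    (hn : 3 ≤ n) {i : Fin r}
    (h : (part i).sortedParts = 2 :: List.replicate (n - 2) 1) :
    Matrix.trace (φ ((indicatorElemInv ℂ S * indicatorElem ℂ T) *
        (indicatorElemInv ℂ T * indicatorElem ℂ U) * (indicatorElemInv ℂ U * indicatorElem ℂ S)) i) =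
      ((∑ y ∈ ((S ×ˢ T) ×ˢ (T ×ˢ U)) ×ˢ (U ×ˢ S),
          (Finset.univ.filter fun p : Fin n =>
            (y.1.1.1⁻¹ * y.1.1.2 * (y.1.2.1⁻¹ * y.1.2.2) * (y.2.1⁻¹ * y.2.2)) p = p).card : ℕ) : ℂ) -
        (((S.card * T.card * U.card) ^ 2 : ℕ) : ℂ) := by
  rw [trace_block_six, hchar i]
  rw [Finset.sum_congr rfl fun y hy => by
    rw [spechtCharacter_of_sortedParts_eq_twoColumn (part i) hn h, sign_six_eq_one hS hT hU hy]]
  simp only [Units.val_one, Int.cast_one, one_mul, Finset.sum_sub_distrib, Finset.sum_const,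
    nsmul_eq_mul, mul_one, card_six, Nat.cast_sum]

/-- The block of `(2, 1^{n-2})` has dimension `n - 1`. [folklore] -/
theorem degree_of_twoColumn (φ : MonoidAlgebra ℂ (Equiv.Perm (Fin n)) ≃ₐ[ℂ] BlockAlgebraC d)
    (part : Fin r → Nat.Partition n) (hchar : ∀ i, (blockRep φ i).character = spechtCharacter ℂ (part i))
    (hn : 3 ≤ n) {i : Fin r}
    (h : (part i).sortedParts = 2 :: List.replicate (n - 2) 1) : d i = n - 1 := by
  have h1 := blockDictionary_character_blockRep_one φ i
  rw [hchar i, spechtCharacter_of_sortedParts_eq_twoColumn (part i) hn h, Equiv.Perm.sign_one] at h1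
  simp only [Units.val_one, Int.cast_one, one_mul, Equiv.Perm.coe_one, id_eq,
    Finset.filter_true_of_mem, Finset.mem_univ, implies_true, Finset.card_univ, Fintype.card_fin] at h1
  have h2 : ((n : ℂ) - 1) = ((n - 1 : ℕ) : ℂ) := by
    rw [Nat.cast_sub (by omega)]; simp
  rw [h2] at h1
  exact_mod_cast h1.symm

end LowBlocks

end Summit.MatrixMultiplication.MatrixMultiplication.Theorems.PolynomialSlack
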